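/-
Copyright (c) 2026 the pub-hodgecm-mathlib formalisation cell (harness21).  Prover seat hodgecm-mathlib-LH4-p13 (g8), req620 Track A «(D-RAM) FOUR-FRAME» squad, tier 0,
STAGE-1b (heir dealer LH4-plan (g13) D-1b draft v1 §3∕§4: (L-lab) lane = the (α′) producer `LabelPlusCleanLawAt n0CleanOfRecord mcOfRecord`): brick (L-lab-13)
«(α′) IN THE DIAGONAL MODEL — THE HERMITIAN HALF»: the trace identity and the no-class criterion of ★ p859272, rewritten in the model label currency of ★ p859223 (form
`diag(c)`, operator `diag(α−1, β−1, 0)`), so that the stratum-wise (α′) proof starts from «model LabelPlus ⇒ every diagonal square `c₀N((α−1)y₀) + c₁N((β−1)y₁)`, `y ∈ M`, lies in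
`ϖ^{m_c}`».  2026-09-04.
-/
import Summits.HodgeConjecture.HodgeConjecture.Theorems.F0P3cDyRamValueSetSkewLineCriterion    -- ★ p859272 (this seat, (L-lab-8)): `exists_skew_near_of_trace_deep`, `not_v_sub_skew_le_of_trace_shallow`; brings ★ (L-lab-3) `valueSetMod_smul_xPlus`, ★ `map_refSkewScalar_eq_neg`
import HarnessLib

/-!
# Crux `H413`, line LH4 «(D-RAM) FOUR-FRAME», STAGE-1b — (L-lab-13) «(α′) IN THE DIAGONAL MODEL, HERMITIAN HALF»: for `α, β ∈ E¹` the model value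
# `v(y) = c₀(α−1)N(y₀) + c₁(β−1)N(y₁)` satisfies `v + σv = −(c₀N((α−1)y₀) + c₁N((β−1)y₁))`; hence model `LabelPlus` forces every diagonal square into `ϖ^{m_c}`, and a
# shallow diagonal square on `M` excludes every transvection class

Cell `hodgecm-mathlib` (D-0151), FLOOR 0, crux item H413 = `stmt-HodgeConjecture-24833`, route of record `HCCMUnconditional`; squad F0∕P3c∕LH4.  STAGE-1b, heir dealer LH4-plan (g13)
D-1b draft v1 (WORD #52) §3 «(L-lab) LH4-p13» ∕ §4 ED. 6 gate (2): the (α′) Prop `LabelPlusCleanLawAt n0CleanOfRecord mcOfRecord` (LH4-p05 (g8) v7) — «on every type-(1) four-frame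
literal at depth ≥ N₀, every fixed type-0 shell vertex with `LatticeLabelPlus` has `(Γ−1)²·M ⊆ ϖ^{m_c}·M`» — is this seat's PROVER TARGET.  THEOREMS ONLY (no `def`, no instance, no
notation, no `sorry`, default heartbeats), ★-only imports, lane `--supports stmt-HodgeConjecture-24833 --as helper`; pays NO row, states NO law.

THE MATHEMATICS.  After ★ p859223 the labelled census of `Γ_b(α, β)` lives in the model `(K³, diag(c))`, `T = diag(α, β, 1)`, with the label read on the norm form
`v(y) := c₀(α−1)·N(y₀) + c₁(β−1)·N(y₁)` (`N(a) = a·σa`, `c_i` `σ`-fixed).  For `α ∈ E¹` one has `σ(α−1) = α⁻¹ − 1 = −(α−1)∕α`, whence `(α−1) + σ(α−1) = −N(α−1)` and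
(§1) **`v(y) + σ(v(y)) = −(c₀·N((α−1)y₀) + c₁·N((β−1)y₁))`** — the model form of ★ p859272's `⟨y,Xy⟩ + σ⟨y,Xy⟩ = −⟨Xy,Xy⟩` (the right side is the `diag(c)`-square of
`diag(α−1, β−1, 0)·y`).  So the abstract criteria of ★ p859272 §2 apply to `a := v(y)`, `s := c₀N((α−1)y₀) + c₁N((β−1)y₁)` (§2): over a ramified datum, if some `y ∈ M` has a SHALLOW
square `|s| > exp(−2n)`, `2n ≤ m + d`, then `v(y)` is far from every skew element, and since `v(y)` is a model value while every value `e·t₊·N(a)` of `e • X₊` is skew (★ (L-lab-3)),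
the model label set `{v(y) | y ∈ M}~` differs from `valueSetMod σ ϖ m (e • X₊)` for EVERY `σ`-fixed `e` (§3) — no class; contrapositively (§4) **model `LabelPlus` (or any class) at
level `m` forces `|c₀N((α−1)y₀) + c₁N((β−1)y₁)| ≤ exp(−2⌊(m+d)∕2⌋)` for all `y ∈ M`** — at `m = m*` the right side is `|ϖ|^{m_c}`: the HERMITIAN half of (α′), valid at EVERY
lattice `M` (no vertex, no fixedness, no fence needed).  The LEVEL conclusion of (α′) (`diag((α−1)², (β−1)², 0)·M ⊆ ϖ^{m_c}·M`, i.e. ★ p859056's six inequalities on the HNF strata) is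
NOT K-wide (this seat's 10:33:45Z witness); it follows stratum by stratum from §4 plus the glue rigidity of the fixed vertex — the next bricks.

* §1 `sub_one_add_map_sub_one` (`(α−1) + σ(α−1) = −N(α−1)` for `ασα = 1`), **`modelValue_add_map_eq_neg_sq`** (the model trace identity).
* §2 `exists_skew_near_modelValue_of_sq_deep`, `not_v_sub_skew_le_modelValue_of_sq_shallow` (★ p859272 §2 instantiated).
* §3 **`setOf_modelValue_ne_valueSetMod_smul_xPlus_of_sq_shallow`** (a shallow diagonal square at some `y ∈ M` ⇒ no class), `not_modelLabel_of_sq_shallow` (`c = 1`).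
* §4 HEAD **`forall_v_sq_le_of_modelLabel`** (model label of class `e` ⇒ all diagonal squares on `M` in `ϖ^{2⌊(m+d)∕2⌋}`).
HONEST LABEL.  Count-neutral brick of the (α′) producer; (α′) itself stays OPEN (stratum assembly pending); the three tier-0 rows stay OPEN; `HC_CM` is proved only modulo the 7
printed citations (2 remaining named inputs: hLiu418 = `stmt-HodgeConjecture-24832`, h413 = `stmt-HodgeConjecture-24833`) until rung 0 closes.

## References
* [Rogawski1990] J. D. Rogawski, *Automorphic Representations of Unitary Groups in Three Variables*, Ann. of Math. Stud. 123 (1990), §4.9 Prop. 4.9.1 (b) p. 55, §3.6 pp. 28–29.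
* [Serre1979] J.-P. Serre, *Local Fields*, GTM 67 (1979), Ch. III §3 Prop. 7 (trace images and the different).
* [Kottwitz1986BaseChangeUnits] R. E. Kottwitz, *Base change for unit elements of Hecke algebras*, Compositio Math. 60 (1986), §1 pp. 240–241.
* [LanglandsShelstad1987] R. P. Langlands, D. Shelstad, *On the definition of transfer factors*, Math. Ann. 278 (1987), §3.
-/

set_option autoImplicit false

noncomputable section

namespace Summit.HodgeConjecture.HodgeConjecture.Cruxes.H413.F0P3cDyRamModelLabelHermitianClean

open Literature.NumberTheory.Automorphic Literature.NumberTheory.Automorphic.HermitianLattice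
open Literature.NumberTheory.Automorphic.UnitaryLatticeTree Literature.NumberTheory.Automorphic.UnitaryThreeFourFrame
open Literature.NumberTheory.LocalFields Literature.NumberTheory.LocalFields.WildQuadraticDatum
open Summit.HodgeConjecture.HodgeConjecture.Cruxes.H413.F0P3cDyRamFourFramePieces
open Summit.HodgeConjecture.HodgeConjecture.Cruxes.H413.F0P3cDyRamSmulXPlusLabel (valueSetMod_smul_xPlus)
open Summit.HodgeConjecture.HodgeConjecture.Cruxes.H413.F0P3cDyRamValueSetSkewLineCriterion (exists_skew_near_of_trace_deep not_v_sub_skew_le_of_trace_shallow)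
open scoped Matrix MatrixGroups Valued
open WithZero

variable {K : Type} [Field K] [Valued K ℤᵐ⁰]

/-! ## §1  The model trace identity -/

omit [Valued K ℤᵐ⁰] in
/-- For `α ∈ E¹` (`α·σα = 1`): `(α − 1) + σ(α − 1) = −(α − 1)·σ(α − 1)`. [cite: Rogawski1990, §3.6 pp. 28–29] -/
theorem sub_one_add_map_sub_one {σ : K →+* K} {α : K} (hα : α * σ α = 1) : (α - 1) + σ (α - 1) = -((α - 1) * σ (α - 1)) := by
  rw [map_sub, map_one]
  linear_combination hα

omit [Valued K ℤᵐ⁰] in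
/-- **THE MODEL TRACE IDENTITY.**  For `α, β ∈ E¹` and `σ`-fixed `c₀, c₁` (`σ` an involution):
`v + σv = −(c₀·N((α−1)y₀) + c₁·N((β−1)y₁))` for `v = c₀(α−1)N(y₀) + c₁(β−1)N(y₁)` — the model form of ★ p859272 `⟨y,Xy⟩ + σ⟨y,Xy⟩ = −⟨Xy,Xy⟩` at `X = diag(α−1, β−1, 0)`,
form `diag(c)`. [cite: Rogawski1990, §4.9 Prop. 4.9.1 (b) p. 55] -/
theorem modelValue_add_map_eq_neg_sq {σ : K →+* K} (hσσ : ∀ a, σ (σ a) = a) {α β c₀ c₁ : K} (hα : α * σ α = 1) (hβ : β * σ β = 1) (hc₀ : σ c₀ = c₀) (hc₁ : σ c₁ = c₁)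
    (y₀ y₁ : K) :
    (c₀ * (α - 1) * (y₀ * σ y₀) + c₁ * (β - 1) * (y₁ * σ y₁)) + σ (c₀ * (α - 1) * (y₀ * σ y₀) + c₁ * (β - 1) * (y₁ * σ y₁)) =
      -(c₀ * (((α - 1) * y₀) * σ ((α - 1) * y₀)) + c₁ * (((β - 1) * y₁) * σ ((β - 1) * y₁))) := by
  have hA := sub_one_add_map_sub_one (σ := σ) hα
  have hB := sub_one_add_map_sub_one (σ := σ) hβ
  simp only [map_add, map_mul, hc₀, hc₁, hσσ]
  rw [map_sub, map_one] at hA hB ⊢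
  rw [map_sub, map_one]
  linear_combination (c₀ * (y₀ * σ y₀)) * hA + (c₁ * (y₁ * σ y₁)) * hB

/-! ## §2  ★ p859272's skew-line criteria at the model value -/

/-- **DEEP SQUARE ⇒ THE MODEL VALUE IS NEAR THE SKEW LINE** (ramified datum; `|c₀N((α−1)y₀) + c₁N((β−1)y₁)| ≤ exp(−j)`, `2n ≤ j + 1`, `m + d ≤ 2n + 1`).
[cite: Serre1979, Ch. III §3 Prop. 7] -/
theorem exists_skew_near_modelValue_of_sq_deep {σ : K →+* K} {ϖ : K} {d t : ℕ} (hσ : ∀ x, σ (σ x) = x)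
    (hfix : ∀ x : K, σ x = x → x ≠ 0 → ∃ n : ℤ, Valued.v x = exp (2 * n))
    (hϖ : Valued.v ϖ = exp (-1 : ℤ)) (hd : Valued.v (ϖ - σ ϖ) = Valued.v ϖ ^ d) (ht : Valued.v (2 : K) = Valued.v ϖ ^ t)
    {α β c₀ c₁ : K} (hα : α * σ α = 1) (hβ : β * σ β = 1) (hc₀ : σ c₀ = c₀) (hc₁ : σ c₁ = c₁) (y₀ y₁ : K) {j n : ℤ} {m : ℕ}
    (hsq : Valued.v (c₀ * (((α - 1) * y₀) * σ ((α - 1) * y₀)) + c₁ * (((β - 1) * y₁) * σ ((β - 1) * y₁))) ≤ exp (-j))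
    (hjn : 2 * n ≤ j + 1) (hmn : (m : ℤ) + d ≤ 2 * n + 1) :
    ∃ z' : K, σ z' = -z' ∧ Valued.v ((ϖ ^ m)⁻¹ * ((c₀ * (α - 1) * (y₀ * σ y₀) + c₁ * (β - 1) * (y₁ * σ y₁)) - z')) ≤ 1 :=
  exists_skew_near_of_trace_deep hσ hfix hϖ hd ht (modelValue_add_map_eq_neg_sq hσ hα hβ hc₀ hc₁ y₀ y₁) hsq hjn hmn

/-- **SHALLOW SQUARE ⇒ THE MODEL VALUE IS FAR FROM THE SKEW LINE** (`|c₀N((α−1)y₀) + c₁N((β−1)y₁)| > exp(−2n)`, `2n ≤ m + d`). [cite: Serre1979, Ch. III §3 Prop. 7] -/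
theorem not_v_sub_skew_le_modelValue_of_sq_shallow {σ : K →+* K} {ϖ : K} {d t : ℕ} (hσ : ∀ x, σ (σ x) = x)
    (hfix : ∀ x : K, σ x = x → x ≠ 0 → ∃ n : ℤ, Valued.v x = exp (2 * n))
    (hϖ : Valued.v ϖ = exp (-1 : ℤ)) (hd : Valued.v (ϖ - σ ϖ) = Valued.v ϖ ^ d) (ht : Valued.v (2 : K) = Valued.v ϖ ^ t)
    {α β c₀ c₁ : K} (hα : α * σ α = 1) (hβ : β * σ β = 1) (hc₀ : σ c₀ = c₀) (hc₁ : σ c₁ = c₁) (y₀ y₁ : K) {n : ℤ} {m : ℕ}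
    (hn : 2 * n ≤ (m : ℤ) + d) (hsq : exp (-(2 * n)) < Valued.v (c₀ * (((α - 1) * y₀) * σ ((α - 1) * y₀)) + c₁ * (((β - 1) * y₁) * σ ((β - 1) * y₁))))
    {z' : K} (hσz' : σ z' = -z') :
    ¬ Valued.v ((ϖ ^ m)⁻¹ * ((c₀ * (α - 1) * (y₀ * σ y₀) + c₁ * (β - 1) * (y₁ * σ y₁)) - z')) ≤ 1 :=
  not_v_sub_skew_le_of_trace_shallow hσ hfix hϖ hd ht (modelValue_add_map_eq_neg_sq hσ hα hβ hc₀ hc₁ y₀ y₁) hn hsq hσz'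

/-! ## §3  A shallow diagonal square on `M` excludes every class -/

/-- **SHALLOW DIAGONAL SQUARE ⇒ NO CLASS (model currency).**  Ramified datum, `α, β ∈ E¹`, `c₀, c₁` `σ`-fixed; if some `y ∈ M` has
`|c₀N((α−1)y₀) + c₁N((β−1)y₁)| > exp(−2n)` with `2n ≤ m + d`, then the model label set `{c₀(α−1)N(y₀) + c₁(β−1)N(y₁) | y ∈ M}~` equals `valueSetMod σ ϖ m (e • X₊)` for NO
`σ`-fixed `e` (its value at `y` is off the skew line; every `e·t₊·N(a)` is on it). [cite: Rogawski1990, §4.9 Prop. 4.9.1 (b) p. 55] [cite: LanglandsShelstad1987, §3] -/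
theorem setOf_modelValue_ne_valueSetMod_smul_xPlus_of_sq_shallow {σ : K →+* K} {ϖ : K} {d t : ℕ} (hσ : ∀ x, σ (σ x) = x)
    (hfix : ∀ x : K, σ x = x → x ≠ 0 → ∃ n : ℤ, Valued.v x = exp (2 * n))
    (hϖ : Valued.v ϖ = exp (-1 : ℤ)) (hd : Valued.v (ϖ - σ ϖ) = Valued.v ϖ ^ d) (ht : Valued.v (2 : K) = Valued.v ϖ ^ t)
    {α β c₀ c₁ : K} (hα : α * σ α = 1) (hβ : β * σ β = 1) (hc₀ : σ c₀ = c₀) (hc₁ : σ c₁ = c₁)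
    {M : Submodule 𝒪[K] (Fin 3 → K)} {y : Fin 3 → K} (hy : y ∈ M) {n : ℤ} {m : ℕ} (hn : 2 * n ≤ (m : ℤ) + d)
    (hsq : exp (-(2 * n)) < Valued.v (c₀ * (((α - 1) * y 0) * σ ((α - 1) * y 0)) + c₁ * (((β - 1) * y 1) * σ ((β - 1) * y 1))))
    {e : K} (hσe : σ e = e) :
    {v | ∃ y ∈ M, Valued.v ((ϖ ^ m)⁻¹ * (v - (c₀ * (α - 1) * (y 0 * σ (y 0)) + c₁ * (β - 1) * (y 1 * σ (y 1))))) ≤ 1} ≠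
      valueSetMod σ ϖ m (e • xPlus σ ϖ d) := by
  intro hEq
  have hmem : (c₀ * (α - 1) * (y 0 * σ (y 0)) + c₁ * (β - 1) * (y 1 * σ (y 1))) ∈
      {v | ∃ y ∈ M, Valued.v ((ϖ ^ m)⁻¹ * (v - (c₀ * (α - 1) * (y 0 * σ (y 0)) + c₁ * (β - 1) * (y 1 * σ (y 1))))) ≤ 1} :=
    ⟨y, hy, by rw [sub_self, mul_zero, map_zero]; exact zero_le_one⟩
  rw [hEq, valueSetMod_smul_xPlus] at hmem
  obtain ⟨a, -, ha⟩ := hmem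
  refine not_v_sub_skew_le_modelValue_of_sq_shallow hσ hfix hϖ hd ht hα hβ hc₀ hc₁ (y 0) (y 1) hn hsq ?_ ha
  rw [map_mul, map_mul, hσe, map_refSkewScalar_eq_neg hσ, map_mul, hσ, mul_comm (σ a) a]
  ring

/-- In particular such an `M` carries **no model `LabelPlus`** (`e = 1`). [cite: Rogawski1990, §4.9 Prop. 4.9.1 (b) p. 55] -/
theorem not_modelLabel_of_sq_shallow {σ : K →+* K} {ϖ : K} {d t : ℕ} (hσ : ∀ x, σ (σ x) = x)
    (hfix : ∀ x : K, σ x = x → x ≠ 0 → ∃ n : ℤ, Valued.v x = exp (2 * n))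
    (hϖ : Valued.v ϖ = exp (-1 : ℤ)) (hd : Valued.v (ϖ - σ ϖ) = Valued.v ϖ ^ d) (ht : Valued.v (2 : K) = Valued.v ϖ ^ t)
    {α β c₀ c₁ : K} (hα : α * σ α = 1) (hβ : β * σ β = 1) (hc₀ : σ c₀ = c₀) (hc₁ : σ c₁ = c₁)
    {M : Submodule 𝒪[K] (Fin 3 → K)} {y : Fin 3 → K} (hy : y ∈ M) {n : ℤ} {m : ℕ} (hn : 2 * n ≤ (m : ℤ) + d)
    (hsq : exp (-(2 * n)) < Valued.v (c₀ * (((α - 1) * y 0) * σ ((α - 1) * y 0)) + c₁ * (((β - 1) * y 1) * σ ((β - 1) * y 1)))) :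
    {v | ∃ y ∈ M, Valued.v ((ϖ ^ m)⁻¹ * (v - (c₀ * (α - 1) * (y 0 * σ (y 0)) + c₁ * (β - 1) * (y 1 * σ (y 1))))) ≤ 1} ≠
      valueSetMod σ ϖ m (xPlus σ ϖ d) := by
  have h := setOf_modelValue_ne_valueSetMod_smul_xPlus_of_sq_shallow hσ hfix hϖ hd ht hα hβ hc₀ hc₁ hy hn hsq (map_one σ)
  rwa [one_smul] at h

/-! ## §4  Head: a model label forces every diagonal square on `M` to be deep (the hermitian half of (α′)) -/

/-- **THE HERMITIAN HALF OF (α′), MODEL CURRENCY.**  Ramified datum, `α, β ∈ E¹`, `c₀, c₁` `σ`-fixed, `M` ANY lattice, `e` `σ`-fixed; if the model label set of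
`diag(α−1, β−1, 0)` on `M` at level `m` equals `valueSetMod σ ϖ m (e • X₊)` (e.g. model `LabelPlus`, `e = 1`), then for every `y ∈ M` and every `n` with `2n ≤ m + d`:
`|c₀N((α−1)y₀) + c₁N((β−1)y₁)| ≤ exp(−2n)` — at `m = m*`, `n = ⌊(m*+d)∕2⌋`: every diagonal `diag(c)`-square of `diag(α−1, β−1, 0)` on `M` lies in `ϖ^{m_c}`.
[cite: Rogawski1990, §4.9 Prop. 4.9.1 (b) p. 55] [cite: Serre1979, Ch. III §3 Prop. 7] [cite: Kottwitz1986BaseChangeUnits, §1 pp. 240–241] -/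
theorem forall_v_sq_le_of_modelLabel {σ : K →+* K} {ϖ : K} {d t : ℕ} (hσ : ∀ x, σ (σ x) = x)
    (hfix : ∀ x : K, σ x = x → x ≠ 0 → ∃ n : ℤ, Valued.v x = exp (2 * n))
    (hϖ : Valued.v ϖ = exp (-1 : ℤ)) (hd : Valued.v (ϖ - σ ϖ) = Valued.v ϖ ^ d) (ht : Valued.v (2 : K) = Valued.v ϖ ^ t)
    {α β c₀ c₁ : K} (hα : α * σ α = 1) (hβ : β * σ β = 1) (hc₀ : σ c₀ = c₀) (hc₁ : σ c₁ = c₁)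
    {M : Submodule 𝒪[K] (Fin 3 → K)} {m : ℕ} {e : K} (hσe : σ e = e)
    (hlab : {v | ∃ y ∈ M, Valued.v ((ϖ ^ m)⁻¹ * (v - (c₀ * (α - 1) * (y 0 * σ (y 0)) + c₁ * (β - 1) * (y 1 * σ (y 1))))) ≤ 1} =
      valueSetMod σ ϖ m (e • xPlus σ ϖ d)) {n : ℤ} (hn : 2 * n ≤ (m : ℤ) + d) :
    ∀ y ∈ M, Valued.v (c₀ * (((α - 1) * y 0) * σ ((α - 1) * y 0)) + c₁ * (((β - 1) * y 1) * σ ((β - 1) * y 1))) ≤ exp (-(2 * n)) := by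
  intro y hy
  by_contra h
  exact setOf_modelValue_ne_valueSetMod_smul_xPlus_of_sq_shallow hσ hfix hϖ hd ht hα hβ hc₀ hc₁ hy hn (not_le.1 h) hσe hlab

end Summit.HodgeConjecture.HodgeConjecture.Cruxes.H413.F0P3cDyRamModelLabelHermitianClean

end
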